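import Mathlib
import HarnessLib
import Literature.Combinatorics.Additive.StepBeyondKempermanTwoHolesPairs

/-!
# Grynkiewicz 2009, §6 Claim 5, third paragraph: `ρ ≥ 2|H|`, hence `|H| = 2` and exactly two cosets on each side

[cite: Grynkiewicz2009, §6 Claim 5 (proof of Thm 4.1, p. 25)] [tag: critical-pair] [tag: inverse-theorem]

Topic `Literature/Combinatorics/Additive`.  Cell `mm-stpp` (D-0046), seat `mm-stpp-lit` (gen 23); the
port of D. J. Grynkiewicz, *A step beyond Kemperman's structure theorem*, Mathematika **55** (2009)
67–114 continued.  §6 Claim 5, THIRD PARAGRAPH (print p. 25), in the setting of the first two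
(`StepBeyondKempermanTwoHoles.lean`: `ρ = |H| + 2` holes among `A` and `B`;
`StepBeyondKempermanTwoHolesPairs.lean`: display (41), and w.l.o.g. the relevant `aᵢ` meet at least two
`H`-cosets, likewise the relevant `bᵢ`): «Hence in view of (41), it follows that `ρ ≥ 2|H|`, with
equality possible only if `|{φ_H(aᵢ)}| = 2` and `|{φ_H(bᵢ)}| = 2`.  Thus in view of `ρ = |H| + 2`, it
follows that `|H| = 2`, that `|{φ_H(aᵢ)}| = 2` and that `|{φ_H(bᵢ)}| = 2`, implying
`φ_H(γ₁) ≠ φ_H(γ₂)` (else `A + B` is periodic, contradicting Claim 1).»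

The implicit matching step («in view of (41), `ρ ≥ 2|H|`») is made explicit: from two relevant pairs
with inequivalent first coordinates and two with inequivalent second coordinates one extracts two
relevant pairs `(x, y), (x′, y′)` with `x ≢ x′` and `y ≢ y′ (mod H)` (`exists_two_disjoint_relevant`);
the holes of `A` in the cosets of `x, x′` and of `B` in those of `y, y′` then number at least
`4|H| − (|A_x| + |B_y|) − (|A_{x′}| + |B_{y′}|) ≥ 2|H|` by (41).

MAIN RESULTS (0 definitions, 0 named facts; everything PROVED).
* `Grynkiewicz2009.exists_two_disjoint_relevant` — the matching step.
* `Grynkiewicz2009.card_add_two_mul_card_add_eq` — hole bookkeeping over two cosets (an identity).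
* `Grynkiewicz2009.card_carrier_eq_two_of_relevant` — `|H| = 2`, with the tightness data: `|A_x| + |B_y|
  = |A_{x′}| + |B_{y′}| = 2` and no hole of `A` (resp. `B`) off the cosets of `x, x′` (resp. `y, y′`).
* `Grynkiewicz2009.sub_mem_or_sub_mem_of_relevant` — «`|{φ_H(aᵢ)}| = 2`»: every relevant `a` is
  `≡ x` or `≡ x′`.
* `Grynkiewicz2009.not_sub_mem_of_two_holes` — «`φ_H(γ₁) ≠ φ_H(γ₂)` (else `A + B` is periodic)» for
  `|H| = 2`.

## References
* D. J. Grynkiewicz, *A step beyond Kemperman's structure theorem*, Mathematika 55 (2009) 67–114,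
  doi:10.1112/S0025579300000966, §6 Claim 5 (p. 25) [cite: Grynkiewicz2009, Thm 4.1 (proof, Claim 5)]
  — held `paper:doi-10-1112-s0025579300000966`, p0025 read 2026-08-29.
-/

namespace Literature.Combinatorics.Additive

open Finset
open scoped Pointwise

universe u

variable {G : Type u} [AddCommGroup G] [DecidableEq G]

namespace Grynkiewicz2009

omit [DecidableEq G] in
/-- **The matching step.**  For any relation `R` («`(a, b)` is a relevant pair») and subgroup `H`: two
`R`-pairs with first coordinates inequivalent mod `H` and two with second coordinates inequivalent
yield two `R`-pairs inequivalent in BOTH coordinates.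
[cite: Grynkiewicz2009, §6 Claim 5 («in view of (41), ρ ≥ 2|H|»)] -/
theorem exists_two_disjoint_relevant {H : AddSubgroup G} {R : G → G → Prop}
    {a b a' b' c d c' d' : G} (h1 : R a b) (h2 : R a' b') (h12 : a - a' ∉ H) (h3 : R c d)
    (h4 : R c' d') (h34 : d - d' ∉ H) :
    ∃ x y x' y' : G, R x y ∧ R x' y' ∧ x - x' ∉ H ∧ y - y' ∉ H := by
  by_cases hb : b - b' ∈ H
  swap
  · exact ⟨a, b, a', b', h1, h2, h12, hb⟩
  -- one of `d, d'` is inequivalent to `b`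
  obtain ⟨e, f, hef, hfb⟩ : ∃ e f : G, R e f ∧ f - b ∉ H := by
    by_cases hdb : d - b ∈ H
    · refine ⟨c', d', h4, fun hd'b => h34 ?_⟩
      have := H.sub_mem hdb hd'b
      rwa [show d - b - (d' - b) = d - d' by abel] at this
    · exact ⟨c, d, h3, hdb⟩
  by_cases hea : e - a ∈ H
  · refine ⟨a', b', e, f, h2, hef, fun h => h12 ?_, fun h => hfb ?_⟩
    · have := H.add_mem h hea
      have := H.neg_mem this
      rwa [show -(a' - e + (e - a)) = a - a' by abel] at this
    · have := H.add_mem hb h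
      have := H.neg_mem this
      rwa [show -(b - b' + (b' - f)) = f - b by abel] at this
  · refine ⟨a, b, e, f, h1, hef, fun h => hea ?_, fun h => hfb ?_⟩
    · have := H.neg_mem h
      rwa [show -(a - e) = e - a by abel] at this
    · have := H.neg_mem h
      rwa [show -(b - f) = f - b by abel] at this

/-- **Hole bookkeeping over two cosets.**  For `x, x′ ∈ A` in different `H`-cosets, with
`U = (x + H) ∪ (x′ + H)` and `R = (A + H) ∖ U`:
`|A| + 2|H| + |R ∖ A| = |A + H| + |A_x| + |A_{x′}|` — i.e. the holes of `A` number
`(|H| − |A_x|) + (|H| − |A_{x′}|)` plus the holes off the two cosets.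
[cite: Grynkiewicz2009, §6 Claim 5 (hole count ρ)] -/
theorem card_add_two_mul_card_add_eq {A Hf : Finset G} {H : AddSubgroup G}
    (hHf : ∀ g, g ∈ Hf ↔ g ∈ H) {x x' : G} (hx : x ∈ A) (hx' : x' ∈ A) (hxx' : x - x' ∉ H) :
    #A + 2 * #Hf + #(((A + Hf) \ ((x +ᵥ Hf) ∪ (x' +ᵥ Hf))) \ A) =
      #(A + Hf) + #(A ∩ (x +ᵥ Hf)) + #(A ∩ (x' +ᵥ Hf)) := by
  classical
  have h0 : (0 : G) ∈ Hf := (hHf 0).2 H.zero_mem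
  set U := (x +ᵥ Hf) ∪ (x' +ᵥ Hf) with hU
  set S := A + Hf with hS
  have hdisj : Disjoint (x +ᵥ Hf) (x' +ᵥ Hf) := by
    rw [disjoint_left]
    intro z hz hz'
    obtain ⟨h₁, hh₁, rfl⟩ := mem_vadd_finset.1 hz
    obtain ⟨h₂, hh₂, he⟩ := mem_vadd_finset.1 hz'
    apply hxx'
    have := H.sub_mem ((hHf _).1 hh₂) ((hHf _).1 hh₁)
    rw [vadd_eq_add, vadd_eq_add] at he
    rwa [show h₂ - h₁ = x - x' by rw [← sub_eq_zero]; rw [← sub_eq_zero] at he; rw [← he]; abel]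
      at this
  have hUS : U ⊆ S := by
    rw [hU, hS]
    refine union_subset (fun z hz => ?_) (fun z hz => ?_)
    · obtain ⟨h, hh, rfl⟩ := mem_vadd_finset.1 hz
      exact add_mem_add hx hh
    · obtain ⟨h, hh, rfl⟩ := mem_vadd_finset.1 hz
      exact add_mem_add hx' hh
  have hAS : A ⊆ S := subset_add_left A h0
  have hcardU : #U = 2 * #Hf := by
    rw [hU, card_union_of_disjoint hdisj, card_vadd_finset, card_vadd_finset]; ring
  have hcardS : #S = #U + #(S \ U) := by
    have := card_le_card hUS
    rw [card_sdiff_of_subset hUS]; omega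
  have hA1 : #(A ∩ U) + #(A \ U) = #A := card_inter_add_card_sdiff A U
  have hA2 : #(A ∩ U) = #(A ∩ (x +ᵥ Hf)) + #(A ∩ (x' +ᵥ Hf)) := by
    rw [hU, inter_union_distrib_left,
      card_union_of_disjoint (hdisj.mono inter_subset_right inter_subset_right)]
  have hR : #(S \ U) = #(A \ U) + #((S \ U) \ A) := by
    have he : (S \ U) ∩ A = A \ U := by
      ext z
      simp only [mem_inter, mem_sdiff]
      constructor
      · rintro ⟨⟨-, h2⟩, h3⟩; exact ⟨h3, h2⟩
      · rintro ⟨h1, h2⟩; exact ⟨⟨hAS h1, h2⟩, h1⟩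
    rw [← card_inter_add_card_sdiff (S \ U) A, he]
  omega

/-- **«Thus `|H| = 2`», with the tightness data.**  In the setting of Claim 5 (`γ₁, γ₂ ∉ A + B`,
`ρ = |H| + 2`, i.e. `|A + H| + |B + H| = |A| + |B| + |H| + 2`, `H ≠ 0`): two relevant pairs
`(x, y), (x′, y′) ∈ A × B` (each with `x + y ≡ γ₁` or `γ₂ (mod H)`) with `x ≢ x′`, `y ≢ y′` force
`|H| = 2`, `|A_x| + |B_y| = |A_{x′}| + |B_{y′}| = 2`, and no hole of `A` (resp. `B`) off the two cosets
`x + H, x′ + H` (resp. `y + H, y′ + H`). [cite: Grynkiewicz2009, §6 Claim 5 (p. 25)] -/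
theorem card_carrier_eq_two_of_relevant {A B Hf : Finset G} {H : AddSubgroup G} {γ₁ γ₂ : G}
    (hHf : ∀ g, g ∈ Hf ↔ g ∈ H) (hH : H ≠ ⊥) (hγ₁ : γ₁ ∉ A + B) (hγ₂ : γ₂ ∉ A + B)
    (hρ : #(A + Hf) + #(B + Hf) = #A + #B + #Hf + 2) {x y x' y' : G} (hx : x ∈ A) (hy : y ∈ B)
    (hxy : x + y - γ₁ ∈ H ∨ x + y - γ₂ ∈ H) (hx' : x' ∈ A) (hy' : y' ∈ B)
    (hxy' : x' + y' - γ₁ ∈ H ∨ x' + y' - γ₂ ∈ H) (hxx' : x - x' ∉ H) (hyy' : y - y' ∉ H) :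
    #Hf = 2 ∧ #(A ∩ (x +ᵥ Hf)) + #(B ∩ (y +ᵥ Hf)) = 2 ∧
      #(A ∩ (x' +ᵥ Hf)) + #(B ∩ (y' +ᵥ Hf)) = 2 ∧
      (A + Hf) \ ((x +ᵥ Hf) ∪ (x' +ᵥ Hf)) ⊆ A ∧ (B + Hf) \ ((y +ᵥ Hf) ∪ (y' +ᵥ Hf)) ⊆ B := by
  classical
  have h2 : 2 ≤ #Hf := by
    obtain ⟨g, hgH, hg0⟩ : ∃ g ∈ H, g ≠ (0 : G) := by
      by_contra hno
      push Not at hno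
      exact hH ((AddSubgroup.eq_bot_iff_forall _).2 hno)
    have hsub : ({0, g} : Finset G) ⊆ Hf :=
      insert_subset ((hHf 0).2 H.zero_mem) (singleton_subset_iff.2 ((hHf g).2 hgH))
    have := card_le_card hsub
    rwa [card_pair hg0.symm] at this
  have h41 : #(A ∩ (x +ᵥ Hf)) + #(B ∩ (y +ᵥ Hf)) ≤ #Hf := by
    rcases hxy with h | h
    · exact card_inter_vadd_add_card_inter_vadd_le hHf hγ₁ h
    · exact card_inter_vadd_add_card_inter_vadd_le hHf hγ₂ h
  have h41' : #(A ∩ (x' +ᵥ Hf)) + #(B ∩ (y' +ᵥ Hf)) ≤ #Hf := by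
    rcases hxy' with h | h
    · exact card_inter_vadd_add_card_inter_vadd_le hHf hγ₁ h
    · exact card_inter_vadd_add_card_inter_vadd_le hHf hγ₂ h
  have hA := card_add_two_mul_card_add_eq hHf hx hx' hxx'
  have hB := card_add_two_mul_card_add_eq hHf hy hy' hyy'
  have hHf2 : #Hf = 2 := by omega
  refine ⟨hHf2, by omega, by omega, ?_, ?_⟩
  · have h0 : #(((A + Hf) \ ((x +ᵥ Hf) ∪ (x' +ᵥ Hf))) \ A) = 0 := by omega
    rw [card_eq_zero, sdiff_eq_empty_iff_subset] at h0
    exact h0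
  · have h0 : #(((B + Hf) \ ((y +ᵥ Hf) ∪ (y' +ᵥ Hf))) \ B) = 0 := by omega
    rw [card_eq_zero, sdiff_eq_empty_iff_subset] at h0
    exact h0

/-- **«`|{φ_H(aᵢ)}| = 2`».**  With `|H| = 2` and no hole of `A` off the cosets `x + H, x′ + H`,
every relevant `a ∈ A` (partner `v ∈ B`, `a + v ≡ γ (mod H)`, `γ ∉ A + B`) is `≡ x` or `≡ x′`: off
those cosets `A_a` is a full coset, so (41) would force `B_v = ∅ ∌ v`.
[cite: Grynkiewicz2009, §6 Claim 5 (p. 25)] -/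
theorem sub_mem_or_sub_mem_of_relevant {A B Hf : Finset G} {H : AddSubgroup G} {γ x x' : G}
    (hHf : ∀ g, g ∈ Hf ↔ g ∈ H) (hHf2 : #Hf = 2) (hγ : γ ∉ A + B)
    (hfull : (A + Hf) \ ((x +ᵥ Hf) ∪ (x' +ᵥ Hf)) ⊆ A) {a v : G} (ha : a ∈ A) (hv : v ∈ B)
    (hav : a + v - γ ∈ H) : a - x ∈ H ∨ a - x' ∈ H := by
  classical
  by_contra hnot
  push Not at hnot
  have hcos : a +ᵥ Hf ⊆ A := by
    intro z hz
    obtain ⟨h, hh, rfl⟩ := mem_vadd_finset.1 hz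
    refine hfull (mem_sdiff.2 ⟨add_mem_add ha hh, fun hU => ?_⟩)
    rw [mem_union] at hU
    rcases hU with hU | hU
    · obtain ⟨h', hh', he⟩ := mem_vadd_finset.1 hU
      apply hnot.1
      have := H.sub_mem ((hHf _).1 hh') ((hHf _).1 hh)
      rw [vadd_eq_add, vadd_eq_add] at he
      rwa [show h' - h = a - x by rw [← sub_eq_zero]; rw [← sub_eq_zero] at he; rw [← he]; abel]
        at this
    · obtain ⟨h', hh', he⟩ := mem_vadd_finset.1 hU
      apply hnot.2
      have := H.sub_mem ((hHf _).1 hh') ((hHf _).1 hh)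
      rw [vadd_eq_add, vadd_eq_add] at he
      rwa [show h' - h = a - x' by rw [← sub_eq_zero]; rw [← sub_eq_zero] at he; rw [← he]; abel]
        at this
  have hAa : #(A ∩ (a +ᵥ Hf)) = 2 := by
    rw [inter_eq_right.2 hcos, card_vadd_finset, hHf2]
  have hBv : 1 ≤ #(B ∩ (v +ᵥ Hf)) :=
    card_pos.2 ⟨v, mem_inter.2 ⟨hv, mem_vadd_finset.2 ⟨0, (hHf 0).2 H.zero_mem, by simp⟩⟩⟩
  have := card_inter_vadd_add_card_inter_vadd_le hHf hγ hav
  omega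

/-- **«`φ_H(γ₁) ≠ φ_H(γ₂)` (else `A + B` is periodic)».**  With `|H| = 2`,
`(A + B) ∪ {γ₁, γ₂} = A + B + H`, `γ₁ ≠ γ₂ ∉ A + B` and `A + B ≠ ∅` aperiodic: `γ₁ − γ₂ ∉ H` — otherwise
`{γ₁, γ₂}` is an `H`-coset and `A + B`, its complement in the periodic set `A + B + H`, is periodic.
[cite: Grynkiewicz2009, §6 Claim 5 (p. 25)] -/
theorem not_sub_mem_of_two_holes {A B Hf : Finset G} {H : AddSubgroup G} {γ₁ γ₂ : G}
    (hHf : ∀ g, g ∈ Hf ↔ g ∈ H) (hH : H ≠ ⊥) (hHf2 : #Hf = 2)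
    (hC' : insert γ₁ (insert γ₂ (A + B)) = A + B + Hf) (hCne : (A + B).Nonempty)
    (haper : (A + B).addStab = {0}) (hγ₁ : γ₁ ∉ A + B) (hγ₂ : γ₂ ∉ A + B) (hne : γ₁ ≠ γ₂) :
    γ₁ - γ₂ ∉ H := by
  classical
  intro hmem
  have hHfper : IsPeriodicWith H Hf := fun h hh => vadd_finset_eq_of_forall_mem_iff hHf hh
  have hcos : γ₁ +ᵥ Hf = ({γ₁, γ₂} : Finset G) := by
    refine (eq_of_subset_of_card_le (fun z hz => ?_) ?_).symm
    · rw [mem_insert, mem_singleton] at hz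
      rcases hz with h | h <;> rw [h]
      · exact mem_vadd_finset.2 ⟨0, (hHf 0).2 H.zero_mem, by simp⟩
      · refine mem_vadd_finset.2 ⟨γ₂ - γ₁, (hHf _).2 ?_, by rw [vadd_eq_add]; abel⟩
        have := H.neg_mem hmem
        rwa [neg_sub] at this
    · rw [card_vadd_finset, hHf2, card_pair hne]
  have hCeq : A + B = (A + B + Hf) \ (γ₁ +ᵥ Hf) := by
    rw [← hC', hcos]
    ext z
    simp only [mem_sdiff, mem_insert, mem_singleton, not_or]
    constructor
    · intro hz
      exact ⟨Or.inr (Or.inr hz), fun h => hγ₁ (h ▸ hz), fun h => hγ₂ (h ▸ hz)⟩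
    · rintro ⟨h | h | h, h1, h2⟩
      · exact absurd h h1
      · exact absurd h h2
      · exact h
  have hper : IsPeriodicWith H (A + B) := by
    intro h hh
    rw [hCeq, vadd_finset_sdiff, (isPeriodicWith_add_of_forall_mem_iff hHf (A + B)) h hh, vadd_vadd,
      add_comm h γ₁, ← vadd_vadd, hHfper h hh]
  exact (isPeriodic_iff_addStab_ne hCne).1 ⟨H, hH, hper⟩ haper

end Grynkiewicz2009

end Literature.Combinatorics.Additive
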